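import Summits.QuantumFields.BalabanUV.T4Continuum.Spine.NE1p.TiltedMeanVisibility

/-!
# T⁴ programme, spine estimate NE1′ (node O3b/H2) — the residual binder `TiltedMeanMatching` from an UNTILTED LAW-LEVEL LEDGER on
# the unit lattice: two ONE-run old-slot visibilities + ONE two-run matching of the old-off class laws

Cell `pub-balaban-gaps` (YM blitz Y1, track G2), seat `ne1` gen 5 (prover-pub-balaban-gaps-ne1-g5-0), record `HOME/ne/NE1.md`
§4 row R40 (gen 5).  SECOND SIBLING of `Spine/NE1p/TiltedMeanVisibility` (same generation): imports it ONLY (for the two-weight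
Lipschitz bound `abs_tiltedMean_withDensity_sub_withDensity_le`, `integrable_coe_of_lintegral_ne_top`, `visibilityConst_mono`, and
through it gen 2's `tiltedMean_comp_eq` ∕ `TiltedMeanMatching`); modifies nothing; no def.

WHAT THIS IS.  File 1 eliminated the tilt from the ONE-run old-slot socket.  This file does the same for the WHOLE residual binder of
NE1′ as the consumer reads it (gen 2: `TiltedMeanMatching l₀ T Bad F ν F′ ν′ η`, `Summable η`), WITHOUT the slot-resolved young
rate of gen 3's crossover: on the unit lattice `X` both runs' class pieces — run A's `(νA K τ).map avg^K` and run B's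
`(νB K τ).map avg^{K+1}` — have densities w.r.t. ONE reference measure `μ` (Haar), and so do the same pieces with the OLD slots
switched off; then
* §A `abs_tiltedMean_comp_sub_comp_le`: the binder's summand `|tiltedMean (W∘πB) νB s − tiltedMean (W∘πA) νA s|` is at most
  `2B·e^{2|s|B}·∫|mB − c·mA| dμ ∕ νB(ΩB)` — NE1.md R23 (b) («conditioned LAW matching, total variation») TYPED with the common
  dominating measure explicit (deferred since gen 2 as «not load-bearing»; typed now because gen 5's point is that law-level inputs
  are exactly the ones that absorb the source tilt, R37);
* §B `abs_tiltedMean_sub_le_three_legs` + **`tiltedMeanMatching_of_lawLedger`**: going full(A) → old-off(A) → old-off(B) → full(B),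
  three UNTILTED, OBSERVABLE-FREE inputs per class — (old A) `∫|gA − c·mA| dμ ∕ ∫gA ≤ oA K`, (young + base) `∫|gB − c′·gA| dμ ∕ ∫gB
  ≤ y K`, (old B) `∫|mB − c″·gB| dμ ∕ ∫mB ≤ oB K` — give `TiltedMeanMatching l₀ T Bad (W∘πA ·) νA (W∘πB ·) νB (fun K =>
  2B·e^{2l₀B}·(oA K + y K + oB K))` for EVERY tilt window `l₀` and every loop `|W| ≤ B` at once; `summable_lawLedgerEta`: summable
  inputs ⇒ the `Summable η` of `DressedMGFForm.hybridNE7_of_mgfForm`.  The two old legs are ONE-run statements (row NE1′'s residue;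
  each ≤ the sum of its per-slot visibilities by file 1's `abs_tiltedMean_chain_le_sum_visibility`, geometric in the age by the
  producer's census); the middle leg is the two-run matching of the old-off laws (young slots + base: rows NE5∕NE9∕NE7-core in law
  currency).  The split old∕young may depend on `K` (a fixed fraction of the `K` levels keeps all three summable when the old
  visibilities are geometric in the age and the young law matching has the two-run rate — `T4Crossover`'s arithmetic, not repeated).
CONSEQUENCE FOR THE ROW.  At the level the consumer reads, NE1′ — «dressed stability of the observable-attached terms, μ-uniform» —
REDUCES to untilted, observable-free law-level statements about the UNDRESSED runs' unit-lattice class pieces; the dressing, the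
source window and the observable survive only in the constant `2B·e^{2l₀B}`.  What is NOT bought: a producer for any of the three
inputs (NE1.md R26: Bałaban's renormalised densities are not the true class marginals past the first ℝ-step; in the application
the old-slot visibilities are the ℝ-defects of old fibres seen from the unit lattice, NE1.md §3 (a) — a READING), nor their rates (the producer's power counting; file 2's toy locates the
second small factor).

HONEST FRAMING.  [folklore] measure theory + bookkeeping over ABSTRACT data (densities on an abstract `X` w.r.t. an abstract `μ`);
hypothesis SHAPES, NOT PRINTED, no producer; NOTHING of Bałaban's is asserted or instantiated.  NE1′ NOT proved; spine 0∕9; (B)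
0∕13; one fixed finite T⁴ — NOT ℝ⁴, NOT infinite volume, NOT a mass gap, NOT Clay.  0 sorry.
-/

noncomputable section

open MeasureTheory ProbabilityTheory Finset
open scoped BigOperators NNReal ENNReal

namespace Summit.QuantumFields.BalabanUV.T4Continuum.NE1p.TiltedMeanVisibility

open Summit.QuantumFields.BalabanUV.T4Continuum.NE1p.DressedMGFForm (tiltedMean tiltedMean_comp_eq TiltedMeanMatching)
open Literature.MathematicalPhysics.QuantumFieldTheory.Balaban1983to89

/-! ## §A Two runs through the unit lattice: both class pieces have densities w.r.t. ONE reference measure -/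

section TwoRun

variable {ΩA ΩB X : Type*} {mΩA : MeasurableSpace ΩA} {mΩB : MeasurableSpace ΩB} {mX : MeasurableSpace X}
  {πA : ΩA → X} {πB : ΩB → X} {νA : Measure ΩA} {νB : Measure ΩB} [IsFiniteMeasure νA] [IsFiniteMeasure νB]
  {μ : Measure X} {W : X → ℝ} {B : ℝ}

/-- A density of a finite push-forward w.r.t. the reference measure is integrable and carries the push-forward's mass. [folklore] -/
theorem integrable_and_integral_eq_of_withDensity_eq_map {Ω : Type*} {mΩ : MeasurableSpace Ω} {π : Ω → X} (hπ : Measurable π)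
    {ν : Measure Ω} [IsFiniteMeasure ν] {m : X → ℝ≥0} (hmm : Measurable m)
    (hm : μ.withDensity (fun x => (m x : ℝ≥0∞)) = ν.map π) :
    Integrable (fun x => (m x : ℝ)) μ ∧ ∫ x, (m x : ℝ) ∂μ = ν.real Set.univ := by
  have hl : ∫⁻ x, (m x : ℝ≥0∞) ∂μ = ν Set.univ := by
    rw [← setLIntegral_univ, ← withDensity_apply _ MeasurableSet.univ, hm, Measure.map_apply hπ MeasurableSet.univ,
      Set.preimage_univ]
  refine ⟨integrable_coe_of_lintegral_ne_top hmm (by rw [hl]; exact measure_ne_top _ _), ?_⟩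
  have h1 : ∫ x, (m x : ℝ) ∂μ = (∫⁻ x, (m x : ℝ≥0∞) ∂μ).toReal := by
    rw [← integral_toReal hmm.coe_nnreal_ennreal.aemeasurable (ae_of_all _ fun x => ENNReal.coe_lt_top)]
    simp only [ENNReal.coe_toReal]
  rw [h1, hl, measureReal_def]

/-- **TWO RUNS, ONE UNIT LATTICE, ONE REFERENCE MEASURE.**  Run A's class piece `νA` on `ΩA` and run B's `νB` on `ΩB` are read on the
unit lattice `X` through `πA = avg^K`, `πB = avg^{K+1}`; if their push-forwards have densities `mA`, `mB` w.r.t. one reference measure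
`μ` on `X` (Haar), then for the loop `W` (`|W| ≤ B`), every tilt `s` and every reference level `c`:
`|tiltedMean (W ∘ πB) νB s − tiltedMean (W ∘ πA) νA s| ≤ 2B·e^{2|s|B}·(∫ |mB − c·mA| dμ) ∕ νB(ΩB)` — the two-run binder's summand
is bounded by an UNTILTED L¹-distance of unit-lattice densities (NE1.md R23 (b), typed). [folklore] -/
theorem abs_tiltedMean_comp_sub_comp_le [NeZero νB] (hπA : Measurable πA) (hπB : Measurable πB) (hWm : Measurable W)
    (hW : ∀ x, |W x| ≤ B) {mA mB : X → ℝ≥0} (hmAm : Measurable mA) (hmBm : Measurable mB) [NeZero νA]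
    (hA : μ.withDensity (fun x => (mA x : ℝ≥0∞)) = νA.map πA) (hB : μ.withDensity (fun x => (mB x : ℝ≥0∞)) = νB.map πB)
    (s c : ℝ) :
    |tiltedMean (W ∘ πB) νB s - tiltedMean (W ∘ πA) νA s|
      ≤ 2 * B * Real.exp (2 * (|s| * B)) * (∫ x, |(mB x : ℝ) - c * mA x| ∂μ) / νB.real Set.univ := by
  obtain ⟨hAi, hAmass⟩ := integrable_and_integral_eq_of_withDensity_eq_map hπA hmAm hA
  obtain ⟨hBi, hBmass⟩ := integrable_and_integral_eq_of_withDensity_eq_map hπB hmBm hB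
  have hA0 : 0 < ∫ x, (mA x : ℝ) ∂μ := by
    rw [hAmass]; exact ENNReal.toReal_pos (Measure.measure_univ_ne_zero.mpr (NeZero.ne νA)) (measure_ne_top _ _)
  have hB0 : 0 < ∫ x, (mB x : ℝ) ∂μ := by
    rw [hBmass]; exact ENNReal.toReal_pos (Measure.measure_univ_ne_zero.mpr (NeZero.ne νB)) (measure_ne_top _ _)
  rw [tiltedMean_comp_eq hπA hWm hW, tiltedMean_comp_eq hπB hWm hW, ← hA, ← hB, ← hBmass]
  exact abs_tiltedMean_withDensity_sub_withDensity_le hWm hW hmAm hAi hA0 hmBm hBi hB0 s c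

end TwoRun

/-! ## §B The binder from an UNTILTED law-level ledger: old visibilities (one run each) + young law matching (two runs) -/

section LawLedger

variable {ι X : Type*} [DecidableEq ι] {mX : MeasurableSpace X} {ΩA ΩB : ℕ → Type*} [∀ K, MeasurableSpace (ΩA K)]
  [∀ K, MeasurableSpace (ΩB K)] {μ : Measure X} {W : X → ℝ} {B l₀ : ℝ} {T : ℕ → Finset ι} {Bad : ℕ → ℝ → Finset ι}
  {πA : ∀ K, ΩA K → X} {πB : ∀ K, ΩB K → X} {νA : ∀ K, ι → Measure (ΩA K)} {νB : ∀ K, ι → Measure (ΩB K)}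

/-- Triangle through two intermediate laws, all with densities w.r.t. `μ`: full(A) → old-off(A) → old-off(B) → full(B).  Each leg is
the two-weight Lipschitz bound of §1 with its own reference level. [folklore] -/
theorem abs_tiltedMean_sub_le_three_legs (hWm : Measurable W) (hW : ∀ x, |W x| ≤ B) {mA gA gB mB : X → ℝ≥0}
    (hmAm : Measurable mA) (hmAi : Integrable (fun x => (mA x : ℝ)) μ) (hmA0 : 0 < ∫ x, (mA x : ℝ) ∂μ)
    (hgAm : Measurable gA) (hgAi : Integrable (fun x => (gA x : ℝ)) μ) (hgA0 : 0 < ∫ x, (gA x : ℝ) ∂μ)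
    (hgBm : Measurable gB) (hgBi : Integrable (fun x => (gB x : ℝ)) μ) (hgB0 : 0 < ∫ x, (gB x : ℝ) ∂μ)
    (hmBm : Measurable mB) (hmBi : Integrable (fun x => (mB x : ℝ)) μ) (hmB0 : 0 < ∫ x, (mB x : ℝ) ∂μ)
    (s cA cY cB : ℝ) :
    |tiltedMean W (μ.withDensity fun x => mB x) s - tiltedMean W (μ.withDensity fun x => mA x) s|
      ≤ 2 * B * Real.exp (2 * (|s| * B)) *
        ((∫ x, |(gA x : ℝ) - cA * mA x| ∂μ) / (∫ x, (gA x : ℝ) ∂μ)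
          + (∫ x, |(gB x : ℝ) - cY * gA x| ∂μ) / (∫ x, (gB x : ℝ) ∂μ)
          + (∫ x, |(mB x : ℝ) - cB * gB x| ∂μ) / (∫ x, (mB x : ℝ) ∂μ)) := by
  have h1 := abs_tiltedMean_withDensity_sub_withDensity_le (μ := μ) hWm hW hmAm hmAi hmA0 hgAm hgAi hgA0 s cA
  have h2 := abs_tiltedMean_withDensity_sub_withDensity_le (μ := μ) hWm hW hgAm hgAi hgA0 hgBm hgBi hgB0 s cY
  have h3 := abs_tiltedMean_withDensity_sub_withDensity_le (μ := μ) hWm hW hgBm hgBi hgB0 hmBm hmBi hmB0 s cB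
  have htri : |tiltedMean W (μ.withDensity fun x => mB x) s - tiltedMean W (μ.withDensity fun x => mA x) s|
      ≤ |tiltedMean W (μ.withDensity fun x => gA x) s - tiltedMean W (μ.withDensity fun x => mA x) s|
        + |tiltedMean W (μ.withDensity fun x => gB x) s - tiltedMean W (μ.withDensity fun x => gA x) s|
        + |tiltedMean W (μ.withDensity fun x => mB x) s - tiltedMean W (μ.withDensity fun x => gB x) s| := by
    have := abs_sub_le (tiltedMean W (μ.withDensity fun x => mB x) s) (tiltedMean W (μ.withDensity fun x => gB x) s)
      (tiltedMean W (μ.withDensity fun x => mA x) s)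
    have := abs_sub_le (tiltedMean W (μ.withDensity fun x => gB x) s) (tiltedMean W (μ.withDensity fun x => gA x) s)
      (tiltedMean W (μ.withDensity fun x => mA x) s)
    linarith
  refine htri.trans ?_
  rw [mul_add, mul_add]
  have e1 : 2 * B * Real.exp (2 * (|s| * B)) * ((∫ x, |(gA x : ℝ) - cA * mA x| ∂μ) / ∫ x, (gA x : ℝ) ∂μ)
      = 2 * B * Real.exp (2 * (|s| * B)) * (∫ x, |(gA x : ℝ) - cA * mA x| ∂μ) / ∫ x, (gA x : ℝ) ∂μ := by ring
  have e2 : 2 * B * Real.exp (2 * (|s| * B)) * ((∫ x, |(gB x : ℝ) - cY * gA x| ∂μ) / ∫ x, (gB x : ℝ) ∂μ)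
      = 2 * B * Real.exp (2 * (|s| * B)) * (∫ x, |(gB x : ℝ) - cY * gA x| ∂μ) / ∫ x, (gB x : ℝ) ∂μ := by ring
  have e3 : 2 * B * Real.exp (2 * (|s| * B)) * ((∫ x, |(mB x : ℝ) - cB * gB x| ∂μ) / ∫ x, (mB x : ℝ) ∂μ)
      = 2 * B * Real.exp (2 * (|s| * B)) * (∫ x, |(mB x : ℝ) - cB * gB x| ∂μ) / ∫ x, (mB x : ℝ) ∂μ := by ring
  rw [e1, e2, e3]
  linarith

/-- **`TiltedMeanMatching` FROM AN UNTILTED LAW-LEVEL LEDGER.**  Data: a reference measure `μ` on the unit lattice `X`; the two runs'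
class pieces `νA K τ`, `νB K τ` read through `πA K`, `πB K`; for each `K`, good `τ`: densities `mA K τ`, `mB K τ` (FULL class
pieces) and `gA K τ`, `gB K τ` (the same pieces with the OLD slots switched OFF), all measurable, integrable, of positive mass,
with `μ.withDensity (mA K τ) = (νA K τ).map (πA K)` and likewise for B.  Hypotheses, ALL UNTILTED and observable-free:
(old A) `∫|gA − c·mA| dμ ∕ ∫gA ≤ oA K`, (young) `∫|gB − c′·gA| dμ ∕ ∫gB ≤ y K`, (old B) `∫|mB − c″·gB| dμ ∕ ∫mB ≤ oB K` for some
reference levels.  Conclusion: for the loop `W` (`|W| ≤ B`, `0 ≤ B`) and every tilt window `l₀`: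
`TiltedMeanMatching l₀ T Bad (W ∘ πA ·) νA (W ∘ πB ·) νB (fun K => 2B·e^{2l₀B}·(oA K + y K + oB K))`.
So the residual binder of NE1′ follows from THREE untilted unit-lattice statements per class: two ONE-run old-slot visibilities (row
NE1′'s residue, observable-free; by `abs_tiltedMean_chain_le_sum_visibility` each is at most the sum of its per-slot visibilities)
and ONE two-run law matching of the old-off pieces (young slots + base: rows NE5∕NE9∕NE7-core in law currency).  NOT PRINTED; no
producer exists for any of the three (NE1.md R26); nothing of Bałaban's asserted. [folklore] -/
theorem tiltedMeanMatching_of_lawLedger (hWm : Measurable W) (hW : ∀ x, |W x| ≤ B) (hB : 0 ≤ B) (hπA : ∀ K, Measurable (πA K))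
    (hπB : ∀ K, Measurable (πB K)) (hνA : ∀ K τ, IsFiniteMeasure (νA K τ)) (hνB : ∀ K τ, IsFiniteMeasure (νB K τ))
    {mA mB gA gB : ℕ → ι → X → ℝ≥0} {oA y oB : ℕ → ℝ}
    (hmeas : ∀ K τ, Measurable (mA K τ) ∧ Measurable (mB K τ) ∧ Measurable (gA K τ) ∧ Measurable (gB K τ))
    (hint : ∀ K τ, Integrable (fun x => (gA K τ x : ℝ)) μ ∧ Integrable (fun x => (gB K τ x : ℝ)) μ)
    (hpos : ∀ K (t : ℝ), |t| ≤ l₀ → ∀ τ ∈ T K \ Bad K t,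
      0 < ∫ x, (mA K τ x : ℝ) ∂μ ∧ 0 < ∫ x, (mB K τ x : ℝ) ∂μ ∧ 0 < ∫ x, (gA K τ x : ℝ) ∂μ ∧ 0 < ∫ x, (gB K τ x : ℝ) ∂μ)
    (hreprA : ∀ K τ, μ.withDensity (fun x => (mA K τ x : ℝ≥0∞)) = (νA K τ).map (πA K))
    (hreprB : ∀ K τ, μ.withDensity (fun x => (mB K τ x : ℝ≥0∞)) = (νB K τ).map (πB K))
    (holdA : ∀ K (t : ℝ), |t| ≤ l₀ → ∀ τ ∈ T K \ Bad K t,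
      ∃ c : ℝ, (∫ x, |(gA K τ x : ℝ) - c * mA K τ x| ∂μ) / (∫ x, (gA K τ x : ℝ) ∂μ) ≤ oA K)
    (hyoung : ∀ K (t : ℝ), |t| ≤ l₀ → ∀ τ ∈ T K \ Bad K t,
      ∃ c : ℝ, (∫ x, |(gB K τ x : ℝ) - c * gA K τ x| ∂μ) / (∫ x, (gB K τ x : ℝ) ∂μ) ≤ y K)
    (holdB : ∀ K (t : ℝ), |t| ≤ l₀ → ∀ τ ∈ T K \ Bad K t,
      ∃ c : ℝ, (∫ x, |(mB K τ x : ℝ) - c * gB K τ x| ∂μ) / (∫ x, (mB K τ x : ℝ) ∂μ) ≤ oB K) :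
    TiltedMeanMatching l₀ T Bad (fun K => W ∘ πA K) νA (fun K => W ∘ πB K) νB
      (fun K => 2 * B * Real.exp (2 * (l₀ * B)) * (oA K + y K + oB K)) := by
  intro K t ht τ hτ s hs
  haveI := hνA K τ
  haveI := hνB K τ
  obtain ⟨hmAm, hmBm, hgAm, hgBm⟩ := hmeas K τ
  obtain ⟨hgAi, hgBi⟩ := hint K τ
  obtain ⟨hmA0, hmB0, hgA0, hgB0⟩ := hpos K t ht τ hτ
  obtain ⟨hmAi, -⟩ := integrable_and_integral_eq_of_withDensity_eq_map (hπA K) hmAm (hreprA K τ)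
  obtain ⟨hmBi, -⟩ := integrable_and_integral_eq_of_withDensity_eq_map (hπB K) hmBm (hreprB K τ)
  obtain ⟨cA, hcA⟩ := holdA K t ht τ hτ
  obtain ⟨cY, hcY⟩ := hyoung K t ht τ hτ
  obtain ⟨cB, hcB⟩ := holdB K t ht τ hτ
  simp only [Function.comp_def]
  rw [show (fun ω => W (πB K ω)) = W ∘ πB K from rfl, show (fun ω => W (πA K ω)) = W ∘ πA K from rfl,
    tiltedMean_comp_eq (hπA K) hWm hW, tiltedMean_comp_eq (hπB K) hWm hW, ← hreprA K τ, ← hreprB K τ]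
  have h := abs_tiltedMean_sub_le_three_legs (μ := μ) hWm hW hmAm hmAi hmA0 hgAm hgAi hgA0 hgBm hgBi hgB0 hmBm hmBi hmB0
    s cA cY cB
  refine h.trans ?_
  have hsum : (∫ x, |(gA K τ x : ℝ) - cA * mA K τ x| ∂μ) / (∫ x, (gA K τ x : ℝ) ∂μ)
      + (∫ x, |(gB K τ x : ℝ) - cY * gA K τ x| ∂μ) / (∫ x, (gB K τ x : ℝ) ∂μ)
      + (∫ x, |(mB K τ x : ℝ) - cB * gB K τ x| ∂μ) / (∫ x, (mB K τ x : ℝ) ∂μ) ≤ oA K + y K + oB K := by linarith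
  have hnn : 0 ≤ oA K + y K + oB K := by
    have : 0 ≤ (∫ x, |(gA K τ x : ℝ) - cA * mA K τ x| ∂μ) / (∫ x, (gA K τ x : ℝ) ∂μ) :=
      div_nonneg (integral_nonneg fun x => abs_nonneg _) hgA0.le
    have : 0 ≤ (∫ x, |(gB K τ x : ℝ) - cY * gA K τ x| ∂μ) / (∫ x, (gB K τ x : ℝ) ∂μ) :=
      div_nonneg (integral_nonneg fun x => abs_nonneg _) hgB0.le
    have : 0 ≤ (∫ x, |(mB K τ x : ℝ) - cB * gB K τ x| ∂μ) / (∫ x, (mB K τ x : ℝ) ∂μ) :=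
      div_nonneg (integral_nonneg fun x => abs_nonneg _) hmB0.le
    linarith
  calc 2 * B * Real.exp (2 * (|s| * B)) * _ ≤ 2 * B * Real.exp (2 * (|s| * B)) * (oA K + y K + oB K) :=
        mul_le_mul_of_nonneg_left hsum (by positivity)
    _ ≤ 2 * B * Real.exp (2 * (l₀ * B)) * (oA K + y K + oB K) :=
        mul_le_mul_of_nonneg_right (visibilityConst_mono hB hs) hnn

/-- Summable untilted inputs give a summable rate for the binder — the `Summable η` the consumer
`DressedMGFForm.hybridNE7_of_mgfForm` asks. [folklore] -/
theorem summable_lawLedgerEta {oA y oB : ℕ → ℝ} (hoA : Summable oA) (hy : Summable y) (hoB : Summable oB) (C : ℝ) :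
    Summable (fun K => C * (oA K + y K + oB K)) :=
  ((hoA.add hy).add hoB).mul_left C

end LawLedger

end Summit.QuantumFields.BalabanUV.T4Continuum.NE1p.TiltedMeanVisibility

end
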